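import Summits.NavierStokesRegularity.NavierStokesRegularity.Theorems.SoloRefuteZeroual2026
import HarnessLib

/-!
# C157 `Zeroual2026` — kit 2 (alongside, records-grade): (5.2) p.8 «modified Brezis–Gallouet–Wainger»
is amplitude-false — `not_Step3_BGW52 : ∀ K, ¬ Step3_BGW52 K`

D-0090 NS-CLAIMS SWEEP, refuter of record ns-claims-refuter-4 g5. The token of record is `Step1_Thm41`
(Theorem 4.1 (4.1) p.7; kit 1 `SoloRefuteZeroual2026.lean`, `not_Step1_Thm41`). This file adds a
kernel object for the print-LATER support display (5.2) p.8 l.22–35 (skeleton `Step3_BGW52 K`, l.273;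
typist's flag: left side degree 1 in `u`, right side degree 0), recorded ALONGSIDE the token — it does
not move the locator or the class.

Mechanism: on the amplitude ray `U_{a,1} = a·U` (`U` = the tree's Ramm test datum) the argument of the
logarithm `‖ΔU_{a,1}‖_{L²}/(Ω_L‖U_{a,1}‖_{L²})` is independent of `a` (`ratio_fam_one`), so the right
side of (5.2) is one constant `R(K)` at `ν = 1`, while `‖∇U_{a,1}(x₁)‖ = a‖∇U(x₁)‖` at a point `x₁`
with `∇U(x₁) ≠ 0` (`exists_fderiv_testDatum_ne_zero`: a compactly supported nonzero field is not
constant); `a = (|R| + 1)/‖∇U(x₁)‖` violates the display. Every `U_{a,1}` is in the typed class `D(A)`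
with `‖U_{a,1}‖_{L²} > 0` and bounded gradient, so this is a countermodel inside the class, not a junk
instance (if `K.Cstar ≤ 0` then `Ω_L = 0` and the right side is `0` by the junk division — the
display then fails at the same witness; the print has `C*_L > 0`, where the witness is honest).

## References
* [Zeroual2026] I. Zeroual, Zenodo 19374469 (2026), (5.2) p.8 l.22–35; Remark 5.1 p.8.

WHAT THIS IS NOT: not a claim about NS regularity or blow-up; not a claim about any author beyond the
typed locator.
-/

noncomputable section

set_option linter.dupNamespace false

open MeasureTheory Set Filter Function Metric
open scoped Topology ENNReal ContDiff Laplacian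

namespace Summit.NavierStokesRegularity.NavierStokesRegularity.Theorems.Zeroual2026

open Literature.Analysis.FluidPDE Literature.Claims.NS.Zeroual2026
open Summit.NavierStokesRegularity.NavierStokesRegularity.Theorems.Magsanop2026 (scaleField
  scaleField_apply contDiff_scaleField hasCompactSupport_scaleField)
open Summit.NavierStokesRegularity.NavierStokesRegularity.Theorems.Ramm2024 (testDatum contDiff_testDatum
  hasCompactSupport_testDatum testDatum_ne_zero)

/-- The test field has a point with nonzero derivative (it is compactly supported and not identically
zero, hence not constant). [folklore] -/
theorem exists_fderiv_testDatum_ne_zero : ∃ x : E3, fderiv ℝ testDatum x ≠ 0 := by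
  suffices h : fderiv ℝ testDatum ≠ 0 from Function.ne_iff.1 h
  intro h
  have h' : ∀ x, fderiv ℝ testDatum x = 0 := fun x => congrFun h x
  have hd : Differentiable ℝ testDatum := contDiff_testDatum.differentiable (by simp)
  obtain ⟨x₀, hx₀⟩ := Function.ne_iff.1 testDatum_ne_zero
  -- a compactly supported function on the non-compact space `E3` vanishes somewhere
  have hK : IsCompact (tsupport testDatum) := hasCompactSupport_testDatum
  obtain ⟨y, hy⟩ : ∃ y, y ∉ tsupport testDatum :=
    not_forall.1 (mt Set.eq_univ_of_forall hK.ne_univ)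
  have hy0 : testDatum y = 0 := image_eq_zero_of_notMem_tsupport hy
  exact hx₀ (by rw [is_const_of_fderiv_eq_zero hd h' x₀ y, hy0]; rfl)

/-- The amplitude ray: `fam a 1 = a • U`. [folklore] -/
theorem fam_one (a : ℝ) : fam a 1 = fun y => a • testDatum y := by
  funext y
  simp [fam]

/-- `∇(a·U)(x) = a·∇U(x)`. [folklore] -/
theorem fderiv_fam_one (a : ℝ) (x : E3) : fderiv ℝ (fam a 1) x = a • fderiv ℝ testDatum x := by
  rw [fam_one]
  exact fderiv_const_smul ((contDiff_testDatum.differentiable (by simp)) x) a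

/-- `∇(a·U)` is bounded (continuous with compact support). [folklore] -/
theorem exists_bound_fderiv_fam_one (a : ℝ) : ∃ B : ℝ, ∀ x, ‖fderiv ℝ (fam a 1) x‖ ≤ B := by
  have hc : Continuous fun x => ‖fderiv ℝ (fam a 1) x‖ :=
    ((contDiff_fam a 1).continuous_fderiv (by simp)).norm
  have hs : HasCompactSupport fun x => ‖fderiv ℝ (fam a 1) x‖ :=
    ((hasCompactSupport_fam a one_ne_zero).fderiv (𝕜 := ℝ)).norm
  obtain ⟨B, hB⟩ := hc.bddAbove_range_of_hasCompactSupport hs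
  exact ⟨B, fun x => hB (Set.mem_range_self x)⟩

/-- `‖U_{a,1}‖_{L²} = a‖U‖_{L²}` for `a > 0`. [folklore] -/
theorem l2_fam_one {a : ℝ} (ha : 0 < a) :
    l2 (fam a 1) = a * Real.sqrt (∫ x, ‖testDatum x‖ ^ 2) := by
  unfold l2
  rw [l2Sq_fam a one_pos, one_pow, inv_one, mul_one, Real.sqrt_mul (sq_nonneg a), Real.sqrt_sq ha.le]

/-- `‖ΔU_{a,1}‖_{L²} = a‖ΔU‖_{L²}` for `a > 0`. [folklore] -/
theorem sqrt_stokesSq_fam_one {a : ℝ} (ha : 0 < a) :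
    Real.sqrt (stokesSq (fam a 1)) = a * Real.sqrt (∫ x, ‖(Δ testDatum) x‖ ^ 2) := by
  rw [stokesSq_fam a one_pos, mul_one, Real.sqrt_mul (sq_nonneg a), Real.sqrt_sq ha.le]

/-- The logarithm's argument in (5.2) does not see the amplitude: along the ray it is one number.
[cite: Zeroual2026, (5.2) p.8 l.22–35] -/
theorem ratio_fam_one (K : Constants) {a : ℝ} (ha : 0 < a) :
    Real.sqrt (stokesSq (fam a 1)) / (OmegaL K 1 * l2 (fam a 1)) =
      Real.sqrt (∫ x, ‖(Δ testDatum) x‖ ^ 2) /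
        (OmegaL K 1 * Real.sqrt (∫ x, ‖testDatum x‖ ^ 2)) := by
  rw [sqrt_stokesSq_fam_one ha, l2_fam_one ha]
  have hL : 0 < Real.sqrt (∫ x, ‖testDatum x‖ ^ 2) := Real.sqrt_pos.2 integral_sq_testDatum_pos
  by_cases hΩ : OmegaL K 1 = 0
  · simp [hΩ]
  · field_simp

/-- **`Step3_BGW52 K` is false for every `K`** ((5.2) p.8 l.22–35, print-LATER than the token (4.1)
p.7; recorded alongside, not keyed): at `ν = 1`, on the amplitude ray `a·U` the right side of (5.2)
is a constant `R` while the left side at a point `x₁` with `∇U(x₁) ≠ 0` is `a‖∇U(x₁)‖`; take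
`a = (|R| + 1)/‖∇U(x₁)‖`. [cite: Zeroual2026, (5.2) p.8 l.22–35] -/
theorem not_Step3_BGW52 (K : Constants) : ¬ Step3_BGW52 K := by
  intro h
  obtain ⟨x₁, hx₁⟩ := exists_fderiv_testDatum_ne_zero
  set g : ℝ := ‖fderiv ℝ testDatum x₁‖ with hg
  have hgpos : 0 < g := norm_pos_iff.2 hx₁
  set R : ℝ := K.CBGW * OmegaL K 1 *
    Real.sqrt (Real.log (Real.exp 1 + Real.sqrt (∫ x, ‖(Δ testDatum) x‖ ^ 2) /
      (OmegaL K 1 * Real.sqrt (∫ x, ‖testDatum x‖ ^ 2)))) with hR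
  set a : ℝ := (|R| + 1) / g with ha
  have hapos : 0 < a := by positivity
  have hl2 : 0 < l2 (fam a 1) := by
    rw [l2_fam_one hapos]
    exact mul_pos hapos (Real.sqrt_pos.2 integral_sq_testDatum_pos)
  have hx := h 1 one_pos (fam a 1) (inDA_fam a one_ne_zero) hl2 (exists_bound_fderiv_fam_one a) x₁
  rw [ratio_fam_one K hapos, ← hR, fderiv_fam_one, norm_smul, Real.norm_eq_abs, abs_of_pos hapos,
    ← hg] at hx
  have hag : a * g = |R| + 1 := by
    rw [ha]
    field_simp
  rw [hag] at hx
  have := le_abs_self R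
  linarith

/-- info: 'Summit.NavierStokesRegularity.NavierStokesRegularity.Theorems.Zeroual2026.not_Step3_BGW52' depends on axioms: [propext, Classical.choice, Quot.sound] -/
#guard_msgs (whitespace := lax) in
#print axioms not_Step3_BGW52

end Summit.NavierStokesRegularity.NavierStokesRegularity.Theorems.Zeroual2026

end
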